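import Mathlib
import Summits.Ventures.PercRepro2.TwoSepFarA3
import Summits.Ventures.PercRepro2.TwoSepFarO
import Summits.Ventures.PercRepro2.TwoSepFarB
import Summits.Ventures.PercRepro2.TwoSepFarRoot
import Summits.Ventures.PercRepro2.TwoSepFarRootB

/-!
# Gluing at a 2-separator, VII: the rule on the REALISED orbits (blind cell PercRepro2, mine-2 g46,
2026-08-29; `conjectures/MINE-2.md` M2-95 addendum 2)

The rules `typedCount_nonneg_of_sep2FarX` ask for nonnegative orbit sums on every real pattern
triple; the census (M2-95 add. 2) says the sums are negative only on «mixed» orbits that the far side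
of a given cell often does not realise.  `nonneg_of_orbit_sums` is the abstract statement behind the
rules — a nonnegative copy-symmetric weight `l` paired with `h`, `6·Σ l·h = Σ l·H` with `H` the
orbit sum of `h` — with the hypothesis only where `l ≠ 0`; the five theorems
`typedCount_nonneg_of_sep2FarX_realised` apply it: **row 2′TRI holds at a one-far-mark 2-separator
as soon as every REALISED orbit sum of the root counts is nonnegative** (the far count of the triple
nonzero).  On the 300,000-cell census this hypothesis holds on 84.4 % of the positive cells with a
split and explains 97 % of the zero cells.  Own work; standard axioms.
-/

namespace Summit.Ventures.PercRepro2

open UnionCluster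

namespace CovForm

namespace RootBridge

open OneTyped TypedA3 Untouched TypedFactor Separated

/-! ## The abstract rule -/

section Abstract

variable {R : Type*} [Field R] [LinearOrder R] [IsStrictOrderedRing R]

/-- The `S₃`-orbit sum of a function on pattern triples. -/
def orbitSum (h : Pat3 → R) (p : Pat3) : R :=
  h p + h (p.2.1, p.1, p.2.2) + h (p.1, p.2.2, p.2.1) + h (p.2.2, p.2.1, p.1) +
    h (p.2.1, p.2.2, p.1) + h (p.2.2, p.1, p.2.1)

/-- **The abstract rule**: a nonnegative weight `l` whose pairing with `h` is invariant under the
six copy permutations of `h` pairs nonnegatively with `h` as soon as the orbit sums of `h` are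
nonnegative wherever `l` is nonzero. -/
theorem nonneg_of_orbit_sums (l h : Pat3 → R) (hl : ∀ p, 0 ≤ l p)
    (h12 : (∑ p : Pat3, l p * h (p.2.1, p.1, p.2.2)) = ∑ p : Pat3, l p * h p)
    (h23 : (∑ p : Pat3, l p * h (p.1, p.2.2, p.2.1)) = ∑ p : Pat3, l p * h p)
    (h13 : (∑ p : Pat3, l p * h (p.2.2, p.2.1, p.1)) = ∑ p : Pat3, l p * h p)
    (hc : (∑ p : Pat3, l p * h (p.2.1, p.2.2, p.1)) = ∑ p : Pat3, l p * h p)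
    (hc' : (∑ p : Pat3, l p * h (p.2.2, p.1, p.2.1)) = ∑ p : Pat3, l p * h p)
    (hH : ∀ p, l p ≠ 0 → 0 ≤ orbitSum h p) :
    0 ≤ ∑ p : Pat3, l p * h p := by
  have h6 : (6 : R) * (∑ p : Pat3, l p * h p) = ∑ p : Pat3, l p * orbitSum h p := by
    unfold orbitSum
    simp only [mul_add, Finset.sum_add_distrib]
    rw [h12, h23, h13, hc, hc']
    ring
  have hpos : (0 : R) ≤ ∑ p : Pat3, l p * orbitSum h p := by
    refine Finset.sum_nonneg fun p _ => ?_
    by_cases hz : l p = 0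
    · rw [hz, zero_mul]
    · exact mul_nonneg (hl p) (hH p hz)
  rw [← h6] at hpos
  exact (mul_nonneg_iff_of_pos_left (by norm_num : (0 : R) < 6)).mp hpos

end Abstract

/-! ## The five rules on the realised orbits -/

section Rules

open Classical

variable {V : Type*} {E : Type*} [Fintype E] [DecidableEq E] {R : Type*} [Field R]
  [LinearOrder R] [IsStrictOrderedRing R]
variable (ends : E → Sym2 V) (o a₁ a₂ a₃ b c d : V)

/-- **Row 2′TRI when `a₃` sits alone behind a 2-separator, from the REALISED orbits**: it suffices
that the orbit sums of the root counts be nonnegative on the triples whose far count is nonzero. -/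
theorem typedCount_nonneg_of_sep2FarA3_realised {VL VH : Set V} (F : Finset E) (z : Config E)
    (τ : E → ℕ) (hτ : ∀ e ∈ F, τ e = 1 ∨ τ e = 2) (h : Sep2FarA3 ends o a₁ a₂ a₃ b c d VL VH F z)
    (hroot : ∀ p : Pat3,
      typedCount (sideF ends VL F) z τ (farK ends c d a₃ VL p : Config E → Config E → Config E → R) ≠ 0 →
      (0 : R) ≤ orbitRoot2A ends o a₁ a₂ b c d VH (sideF ends VH F) z τ p) :
    0 ≤ typedCount F z τ (K3 ends o a₁ a₂ a₃ b : Config E → Config E → Config E → R) := by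
  rw [typedCount_eq_sep2FarA3 ends o a₁ a₂ a₃ b c d F z τ h]
  have hτA : ∀ e ∈ sideF ends VL F, τ e = 1 ∨ τ e = 2 := fun e he => hτ e (Finset.filter_subset _ _ he)
  refine mul_nonneg ?_ (typedCount_nonneg_of_nonneg _ _ _ fun _ _ _ => zero_le_one)
  refine nonneg_of_orbit_sums (fun p => typedCount (sideF ends VL F) z τ (farK ends c d a₃ VL p))
    (fun p => typedCount (sideF ends VH F) z τ (rootK2A ends o a₁ a₂ b c d VH p))
    (fun p => farCount_nonneg ends c d a₃ VL _ z τ p) ?_ ?_ ?_ ?_ ?_ hroot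
  · exact sum_far_root_perm ends o a₁ a₂ a₃ b c d VL VH _ _ z τ _
      (Function.Involutive.bijective fun _ => rfl) (fun p => farCount_swap12 ends c d a₃ VL _ z τ p)
  · exact sum_far_root_perm ends o a₁ a₂ a₃ b c d VL VH _ _ z τ _
      (Function.Involutive.bijective fun _ => rfl) (fun p => farCount_swap23 ends c d a₃ VL _ z τ hτA p)
  · exact sum_far_root_perm ends o a₁ a₂ a₃ b c d VL VH _ _ z τ _
      (Function.Involutive.bijective fun _ => rfl) (fun p => farCount_swap13 ends c d a₃ VL _ z τ hτA p)
  · exact sum_far_root_perm ends o a₁ a₂ a₃ b c d VL VH _ _ z τ _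
      (Function.bijective_iff_has_inverse.mpr ⟨fun p => (p.2.2, p.1, p.2.1), fun _ => rfl, fun _ => rfl⟩)
      (fun p => farCount_cyc ends c d a₃ VL _ z τ hτA p)
  · exact sum_far_root_perm ends o a₁ a₂ a₃ b c d VL VH _ _ z τ _
      (Function.bijective_iff_has_inverse.mpr ⟨fun p => (p.2.1, p.2.2, p.1), fun _ => rfl, fun _ => rfl⟩)
      (fun p => farCount_cyc' ends c d a₃ VL _ z τ hτA p)

/-- The same for `o` alone behind the separator. -/
theorem typedCount_nonneg_of_sep2FarO_realised {VL VH : Set V} (F : Finset E) (z : Config E)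
    (τ : E → ℕ) (hτ : ∀ e ∈ F, τ e = 1 ∨ τ e = 2) (h : Sep2FarO ends o a₁ a₂ a₃ b c d VL VH F z)
    (hroot : ∀ p : Pat3,
      typedCount (sideF ends VL F) z τ (farK ends c d o VL p : Config E → Config E → Config E → R) ≠ 0 →
      (0 : R) ≤ orbitRoot2O ends a₁ a₂ a₃ b c d VH (sideF ends VH F) z τ p) :
    0 ≤ typedCount F z τ (K3 ends o a₁ a₂ a₃ b : Config E → Config E → Config E → R) := by
  rw [typedCount_eq_sep2FarO ends o a₁ a₂ a₃ b c d F z τ h]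
  have hτA : ∀ e ∈ sideF ends VL F, τ e = 1 ∨ τ e = 2 := fun e he => hτ e (Finset.filter_subset _ _ he)
  refine mul_nonneg ?_ (typedCount_nonneg_of_nonneg _ _ _ fun _ _ _ => zero_le_one)
  refine nonneg_of_orbit_sums (fun p => typedCount (sideF ends VL F) z τ (farK ends c d o VL p))
    (fun p => typedCount (sideF ends VH F) z τ (rootK2O ends a₁ a₂ a₃ b c d VH p))
    (fun p => farCount_nonneg ends c d o VL _ z τ p) ?_ ?_ ?_ ?_ ?_ hroot
  · exact sum_far_root_permO ends o a₁ a₂ a₃ b c d VL VH _ _ z τ _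
      (Function.Involutive.bijective fun _ => rfl) (fun p => farCount_swap12 ends c d o VL _ z τ p)
  · exact sum_far_root_permO ends o a₁ a₂ a₃ b c d VL VH _ _ z τ _
      (Function.Involutive.bijective fun _ => rfl) (fun p => farCount_swap23 ends c d o VL _ z τ hτA p)
  · exact sum_far_root_permO ends o a₁ a₂ a₃ b c d VL VH _ _ z τ _
      (Function.Involutive.bijective fun _ => rfl) (fun p => farCount_swap13 ends c d o VL _ z τ hτA p)
  · exact sum_far_root_permO ends o a₁ a₂ a₃ b c d VL VH _ _ z τ _
      (Function.bijective_iff_has_inverse.mpr ⟨fun p => (p.2.2, p.1, p.2.1), fun _ => rfl, fun _ => rfl⟩)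
      (fun p => farCount_cyc ends c d o VL _ z τ hτA p)
  · exact sum_far_root_permO ends o a₁ a₂ a₃ b c d VL VH _ _ z τ _
      (Function.bijective_iff_has_inverse.mpr ⟨fun p => (p.2.1, p.2.2, p.1), fun _ => rfl, fun _ => rfl⟩)
      (fun p => farCount_cyc' ends c d o VL _ z τ hτA p)

/-- The same for `b` alone behind the separator. -/
theorem typedCount_nonneg_of_sep2FarB_realised {VL VH : Set V} (F : Finset E) (z : Config E)
    (τ : E → ℕ) (hτ : ∀ e ∈ F, τ e = 1 ∨ τ e = 2) (h : Sep2FarB ends o a₁ a₂ a₃ b c d VL VH F z)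
    (hroot : ∀ p : Pat3,
      typedCount (sideF ends VL F) z τ (farK ends c d b VL p : Config E → Config E → Config E → R) ≠ 0 →
      (0 : R) ≤ orbitRoot2B ends o a₁ a₂ a₃ c d VH (sideF ends VH F) z τ p) :
    0 ≤ typedCount F z τ (K3 ends o a₁ a₂ a₃ b : Config E → Config E → Config E → R) := by
  rw [typedCount_eq_sep2FarB ends o a₁ a₂ a₃ b c d F z τ h]
  have hτA : ∀ e ∈ sideF ends VL F, τ e = 1 ∨ τ e = 2 := fun e he => hτ e (Finset.filter_subset _ _ he)
  refine mul_nonneg ?_ (typedCount_nonneg_of_nonneg _ _ _ fun _ _ _ => zero_le_one)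
  refine nonneg_of_orbit_sums (fun p => typedCount (sideF ends VL F) z τ (farK ends c d b VL p))
    (fun p => typedCount (sideF ends VH F) z τ (rootK2B ends o a₁ a₂ a₃ c d VH p))
    (fun p => farCount_nonneg ends c d b VL _ z τ p) ?_ ?_ ?_ ?_ ?_ hroot
  · exact sum_far_root_permB ends o a₁ a₂ a₃ b c d VL VH _ _ z τ _
      (Function.Involutive.bijective fun _ => rfl) (fun p => farCount_swap12 ends c d b VL _ z τ p)
  · exact sum_far_root_permB ends o a₁ a₂ a₃ b c d VL VH _ _ z τ _
      (Function.Involutive.bijective fun _ => rfl) (fun p => farCount_swap23 ends c d b VL _ z τ hτA p)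
  · exact sum_far_root_permB ends o a₁ a₂ a₃ b c d VL VH _ _ z τ _
      (Function.Involutive.bijective fun _ => rfl) (fun p => farCount_swap13 ends c d b VL _ z τ hτA p)
  · exact sum_far_root_permB ends o a₁ a₂ a₃ b c d VL VH _ _ z τ _
      (Function.bijective_iff_has_inverse.mpr ⟨fun p => (p.2.2, p.1, p.2.1), fun _ => rfl, fun _ => rfl⟩)
      (fun p => farCount_cyc ends c d b VL _ z τ hτA p)
  · exact sum_far_root_permB ends o a₁ a₂ a₃ b c d VL VH _ _ z τ _
      (Function.bijective_iff_has_inverse.mpr ⟨fun p => (p.2.1, p.2.2, p.1), fun _ => rfl, fun _ => rfl⟩)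
      (fun p => farCount_cyc' ends c d b VL _ z τ hτA p)

/-- The same for the root `a₁` alone behind the separator. -/
theorem typedCount_nonneg_of_sep2FarRoot_realised {VL VH : Set V} (F : Finset E) (z : Config E)
    (τ : E → ℕ) (hτ : ∀ e ∈ F, τ e = 1 ∨ τ e = 2) (h : Sep2FarRoot ends o a₁ a₂ a₃ b c d VL VH F z)
    (hroot : ∀ p : Pat3,
      typedCount (sideF ends VL F) z τ (farK ends c d a₁ VL p : Config E → Config E → Config E → R) ≠ 0 →
      (0 : R) ≤ orbitRoot2R ends o a₂ a₃ b c d VH (sideF ends VH F) z τ p) :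
    0 ≤ typedCount F z τ (K3 ends o a₁ a₂ a₃ b : Config E → Config E → Config E → R) := by
  rw [typedCount_eq_sep2FarRoot ends o a₁ a₂ a₃ b c d F z τ h]
  have hτA : ∀ e ∈ sideF ends VL F, τ e = 1 ∨ τ e = 2 := fun e he => hτ e (Finset.filter_subset _ _ he)
  refine mul_nonneg ?_ (typedCount_nonneg_of_nonneg _ _ _ fun _ _ _ => zero_le_one)
  refine nonneg_of_orbit_sums (fun p => typedCount (sideF ends VL F) z τ (farK ends c d a₁ VL p))
    (fun p => typedCount (sideF ends VH F) z τ (rootK2R ends o a₂ a₃ b c d VH p))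
    (fun p => farCount_nonneg ends c d a₁ VL _ z τ p) ?_ ?_ ?_ ?_ ?_ hroot
  · exact sum_far_root_permR ends o a₁ a₂ a₃ b c d VL VH _ _ z τ _
      (Function.Involutive.bijective fun _ => rfl) (fun p => farCount_swap12 ends c d a₁ VL _ z τ p)
  · exact sum_far_root_permR ends o a₁ a₂ a₃ b c d VL VH _ _ z τ _
      (Function.Involutive.bijective fun _ => rfl) (fun p => farCount_swap23 ends c d a₁ VL _ z τ hτA p)
  · exact sum_far_root_permR ends o a₁ a₂ a₃ b c d VL VH _ _ z τ _
      (Function.Involutive.bijective fun _ => rfl) (fun p => farCount_swap13 ends c d a₁ VL _ z τ hτA p)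
  · exact sum_far_root_permR ends o a₁ a₂ a₃ b c d VL VH _ _ z τ _
      (Function.bijective_iff_has_inverse.mpr ⟨fun p => (p.2.2, p.1, p.2.1), fun _ => rfl, fun _ => rfl⟩)
      (fun p => farCount_cyc ends c d a₁ VL _ z τ hτA p)
  · exact sum_far_root_permR ends o a₁ a₂ a₃ b c d VL VH _ _ z τ _
      (Function.bijective_iff_has_inverse.mpr ⟨fun p => (p.2.1, p.2.2, p.1), fun _ => rfl, fun _ => rfl⟩)
      (fun p => farCount_cyc' ends c d a₁ VL _ z τ hτA p)

/-- The same for the root `a₂` alone behind the separator. -/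
theorem typedCount_nonneg_of_sep2FarRootB_realised {VL VH : Set V} (F : Finset E) (z : Config E)
    (τ : E → ℕ) (hτ : ∀ e ∈ F, τ e = 1 ∨ τ e = 2) (h : Sep2FarRootB ends o a₁ a₂ a₃ b c d VL VH F z)
    (hroot : ∀ p : Pat3,
      typedCount (sideF ends VL F) z τ (farK ends c d a₂ VL p : Config E → Config E → Config E → R) ≠ 0 →
      (0 : R) ≤ orbitRoot2RB ends o a₁ a₃ b c d VH (sideF ends VH F) z τ p) :
    0 ≤ typedCount F z τ (K3 ends o a₁ a₂ a₃ b : Config E → Config E → Config E → R) := by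
  rw [typedCount_eq_sep2FarRootB ends o a₁ a₂ a₃ b c d F z τ h]
  have hτA : ∀ e ∈ sideF ends VL F, τ e = 1 ∨ τ e = 2 := fun e he => hτ e (Finset.filter_subset _ _ he)
  refine mul_nonneg ?_ (typedCount_nonneg_of_nonneg _ _ _ fun _ _ _ => zero_le_one)
  refine nonneg_of_orbit_sums (fun p => typedCount (sideF ends VL F) z τ (farK ends c d a₂ VL p))
    (fun p => typedCount (sideF ends VH F) z τ (rootK2RB ends o a₁ a₃ b c d VH p))
    (fun p => farCount_nonneg ends c d a₂ VL _ z τ p) ?_ ?_ ?_ ?_ ?_ hroot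
  · exact sum_far_root_permRB ends o a₁ a₂ a₃ b c d VL VH _ _ z τ _
      (Function.Involutive.bijective fun _ => rfl) (fun p => farCount_swap12 ends c d a₂ VL _ z τ p)
  · exact sum_far_root_permRB ends o a₁ a₂ a₃ b c d VL VH _ _ z τ _
      (Function.Involutive.bijective fun _ => rfl) (fun p => farCount_swap23 ends c d a₂ VL _ z τ hτA p)
  · exact sum_far_root_permRB ends o a₁ a₂ a₃ b c d VL VH _ _ z τ _
      (Function.Involutive.bijective fun _ => rfl) (fun p => farCount_swap13 ends c d a₂ VL _ z τ hτA p)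
  · exact sum_far_root_permRB ends o a₁ a₂ a₃ b c d VL VH _ _ z τ _
      (Function.bijective_iff_has_inverse.mpr ⟨fun p => (p.2.2, p.1, p.2.1), fun _ => rfl, fun _ => rfl⟩)
      (fun p => farCount_cyc ends c d a₂ VL _ z τ hτA p)
  · exact sum_far_root_permRB ends o a₁ a₂ a₃ b c d VL VH _ _ z τ _
      (Function.bijective_iff_has_inverse.mpr ⟨fun p => (p.2.1, p.2.2, p.1), fun _ => rfl, fun _ => rfl⟩)
      (fun p => farCount_cyc' ends c d a₂ VL _ z τ hτA p)

end Rules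

end RootBridge

end CovForm

end Summit.Ventures.PercRepro2
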